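import Literature.MathematicalPhysics.QuantumFieldTheory.Balaban1983to89.Node00.Carriers3
import Literature.MathematicalPhysics.QuantumFieldTheory.Balaban1983to89.Node00.Satisfiable

/-!
# `Balaban1983to89.B10NodeKnit` — DAG node N08 · [Balaban1985UV3]: the first tree theorems CONCLUDING
# `Dag.B10_main (DagBinding.leavesP w P)` BY NAME, under BOTH readings of its own leaf `b10`, and what the Stage-3
# record of NODE 00 does and does not decide about it

T. Bałaban, *Ultraviolet stability of three-dimensional lattice pure gauge field theories*, Commun. Math. Phys. **102**
(1985) 255–275 [Balaban1985UV3] (cell paper B10; node N08 of the YM-PLAN Track-A DAG).  Theorem 1 p. 257 (the bounds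
(5) p. 256, with p. 257 l. 1 «and the constant O(1) is independent of ε, k, g_k in a bounded set») and Theorem 2 p. 272
(the inductive inequalities (41) p. 266, (47) p. 267); the author, p. 257: «the proof is very sketchy».

KNIT-BY-NAME MODULE of seat `pub-ymgap-dag-n08-a` (HUMAN RULING D-0062, chair R429∕R430).  THE NODE (tree `…Dag`, :207):
`Dag.B10_main ℓ := ℓ.b5 → ℓ.b6 → ℓ.b7 → ℓ.b8 → ℓ.b9 → ℓ.b11 → ℓ.b10` — «conclusions of [B5], [B6], [B7], [B8], [B9], [B11] ⇒
Theorem 1 ∧ Theorem 2».  Its statement of record is `Dag.B10_main (DagBinding.leavesP w P)` at the worlds of record `w`;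
at the N-binding `DagBinding.Upstream.ofPrintedAllXPN X Y Z V W` (the binding every NODE 00 stage carries) the node's OWN
leaf is the LITERAL typing `b10 = B10.Thm1Printed X.runs10 ∧ B10.Thm2Printed X.runs10` (one constant per bounded coupling
set).  Two kernel facts of the tree frame this node: (α) `B10Assembly.thm1Compact_and_thm2_of_leafSystem` — every
family of tower runs carrying `B10Assembly.LeafSystem`s with common constants satisfies the COMPACT reading
`B10.Thm1PrintedCompact ∧ B10.Thm2Printed` (one constant per compact coupling window, cell GAPS G-B10-01; the node
`DagDischarged.b10Compact`); (β) `B10DagLeaf.not_thm1Printed_of_fineLattices` — on such a family containing arbitrarily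
fine lattices (g fixed, ε → 0: the continuum limit the paper is about) the LITERAL `B10.Thm1Printed` FAILS, because
E^{(k)} of (62) p. 271 carries `d(𝔤) log g_k |T₁^{(k)*}|`.  Which reading node N08 asserts «of record» is the open
ruling Q2 (YM-PLAN §9).  This module lands N08 under BOTH readings, side by side, so that the ruling costs nothing:

* §1 node shape (binding-agnostic, `Iff.rfl` bookkeeping): the node IS its leaf once the six in-edges hold; if the
  leaf fails, the node holds iff an in-edge fails (the «XP-hazard» of the plan's vacuity guard, in kernel form).
* §2 the node at a run of a world bound by the N-binding over explicit carriers (`w.up P = ofPrintedAllXPN X Y Z V W`).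
* §3 NEW real bookkeeping: the LITERAL Theorem 1 follows from the COMPACT one under a COUPLING FLOOR
  (`thm1Printed_of_thm1Compact_of_floor`), and a leaf-system family whose lattice spacings are bounded below
  (`ε_i ≥ ε₀ > 0`: a COARSE sub-family) has the floor `g·√ε₀` (p. 256 «g_k = g(L^kε)^{1/2}») — so on coarse
  leaf-system families the LITERAL leaf `Thm1Printed ∧ Thm2Printed` HOLDS (`b10Leaf_of_leafSystems_of_coarse`).
* §4 N08 BY NAME at a world whose B10 runs are leaf-system tower runs (`X.withTowerRuns10 T`): (L-coarse)
  `b10_main_of_leafSystems_of_coarse : Dag.B10_main (leavesP w P)` — the first tree theorem concluding node N08's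
  statement at a binding over [Balaban1985UV3]'s own leaf system; (L-fine) `not_b10_main_of_fineLattices`: with the
  reader's items (R1)–(R3) of `…B10DagLeaf` and fine lattices the node FAILS as soon as its six in-edges hold, i.e.
  `Dag.B10_main (leavesP w P) ↔ ¬ (b5 ∧ b6 ∧ b7 ∧ b8 ∧ b9 ∧ b11)` there; (C) `b10_main_of_upCompact`: at a world bound by
  the N-binding with the ONE slot `b10` re-read as `DagDischarged.b10Compact` (the Q2 candidate binding, written as a
  structure update — NO new definition is introduced here), N08 holds from the leaf systems ALONE, in-edges unused;
  the record-predicate form `b10_main_at_record_of_leafSystemPin` is the shape a `stub_N08` closes against.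
* §5 the three edges UNCONDITIONALLY on the b10 lineage's model family `B10DagLeaf.logRun` (d(𝔤) = 3, ρ_k ≡ e^{−E_k},
  ε = 2^{−K}): compact N08 true; literal N08 ↔ «an in-edge fails»; literal N08 TRUE on every single-spacing sub-family.
* §6 STAGE 3 OF NODE 00 DOES NOT DECIDE LEAF `b10`: `carriers₃ θ X` leaves the B10 run family FREE
  (`carriers₃_groupB10`), the node unfolds to `b6(D6OfRecord θ) → b8 → b9 → b11 → Thm1Printed X.runs10 ∧ Thm2Printed X.runs10`
  (`b10_main_iff_of_up₃`), admissible Stage-3 parameters exist (`exists_stage3Params_admissible`), and there are Stage-3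
  worlds of record with leaf `b10` TRUE (empty run family) and with leaf `b10` FALSE (the `logRun` family) —
  `isWorldOfRecord₃_b10_undecided`; the Carriers3-pattern slot hypothesis «∀ X, b10» is refutable
  (`not_forall_b10_leaf`).  Consequence for the plan: N08 needs (i) a NODE 00 stage pinning `runs10` to Bałaban's
  (1)–(2) towers (r07's `B10Eq2DensityTower`) and (ii) the Q2 word, before it can be discharged or r-booked.

HONEST FRAMING.  Count-neutral KERNEL BOOKKEEPING by name over the b2b ∕ lit-balaban lineages' theorems
(`B10Assembly`, `B10DagLeaf`, `DagDischarged` §LeafB10Literal, `Node00.Carriers*`); the only new mathematics is the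
elementary real-analysis of §3.  NOTHING of [Balaban1985UV3] is asserted: `LeafSystem`, (R1)–(R3), `FineLattices`
are HYPOTHESES; whether Bałaban's densities (1)–(2) carry leaf systems is the XL content of the paper (the -b seat's
hunt).  Theorems only (no `def`), 0 sorry, axioms {propext, Classical.choice, Quot.sound}.  One finite four-torus
programme at fixed ε downstream; nothing here about the continuum limit, ℝ⁴, OS axioms, a mass gap or the Clay problem.
-/

noncomputable section

namespace Literature.MathematicalPhysics.QuantumFieldTheory.Balaban1983to89.B10NodeKnit

open DagBinding DagDischargedII Node00
open B10 (RunData TowerRun Thm1Printed Thm2Printed Thm1PrintedCompact Bounds5 Bounds5At bounds5_iff gRun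
  thm1Compact_of_thm1Printed)
open B10Assembly (LeafSystem thm1Compact_and_thm2_of_leafSystem)
open B10DagLeaf (UnitConfig0 StarLower DgLower FineLattices logRun logConsts logLeafSystem)
open DagDischarged (b10Compact)

/-! ## §1. Node shape (binding-agnostic bookkeeping) -/

section Shape

variable (ℓ : Dag.Leaves)

/-- The node unfolded (`Iff.rfl`): «[B5] ∧ [B6] ∧ [B7] ∧ [B8] ∧ [B9] ∧ [B11] conclusions ⇒ own leaf `b10`». [cite: Balaban1985UV3, Thm 1 p.257 + Thm 2 p.272 (node shape, bookkeeping)] -/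
theorem b10_main_iff : Dag.B10_main ℓ ↔ (ℓ.b5 → ℓ.b6 → ℓ.b7 → ℓ.b8 → ℓ.b9 → ℓ.b11 → ℓ.b10) := Iff.rfl

variable {ℓ}

/-- The leaf alone gives the node (in-edges unused). [cite: Balaban1985UV3, Thm 1 p.257 + Thm 2 p.272 (node shape, bookkeeping)] -/
theorem b10_main_of_leaf (h : ℓ.b10) : Dag.B10_main ℓ := fun _ _ _ _ _ _ => h

/-- Once the six in-edge leaves hold, the node IS its own leaf. [cite: Balaban1985UV3, Thm 1 p.257 + Thm 2 p.272 (node shape, bookkeeping)] -/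
theorem b10_main_iff_leaf_of_inEdges (h5 : ℓ.b5) (h6 : ℓ.b6) (h7 : ℓ.b7) (h8 : ℓ.b8) (h9 : ℓ.b9) (h11 : ℓ.b11) :
    Dag.B10_main ℓ ↔ ℓ.b10 :=
  ⟨fun h => h h5 h6 h7 h8 h9 h11, fun h _ _ _ _ _ _ => h⟩

/-- If the leaf FAILS, the node holds iff one of its six in-edges fails — the plan's «XP-hazard ∕ vacuity guard» for a
refuted-as-typed leaf, in kernel form. [cite: Balaban1985UV3, Thm 1 p.257 + Thm 2 p.272 (node shape, bookkeeping)] -/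
theorem b10_main_iff_not_inEdges_of_not_leaf (h : ¬ ℓ.b10) :
    Dag.B10_main ℓ ↔ ¬ (ℓ.b5 ∧ ℓ.b6 ∧ ℓ.b7 ∧ ℓ.b8 ∧ ℓ.b9 ∧ ℓ.b11) :=
  ⟨fun hn ⟨h5, h6, h7, h8, h9, h11⟩ => h (hn h5 h6 h7 h8 h9 h11),
    fun hn h5 h6 h7 h8 h9 h11 => absurd ⟨h5, h6, h7, h8, h9, h11⟩ hn⟩

/-- At the `leavesP` binding the node's own leaf is the world's upstream slot `b10` (`rfl`). [cite: Balaban1985UV3, Thm 1 p.257 + Thm 2 p.272 (dictionary, bookkeeping)] -/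
theorem leavesP_b10 (w : WorldP) (P : B12.RunParams) : (leavesP w P).b10 = (w.up P).b10 := rfl

/-- N08's statement of record unfolded at the `leavesP` binding (`Iff.rfl`). [cite: Balaban1985UV3, Thm 1 p.257 + Thm 2 p.272 (node shape, bookkeeping)] -/
theorem b10_main_leavesP_iff (w : WorldP) (P : B12.RunParams) :
    Dag.B10_main (leavesP w P) ↔
      ((w.up P).b5 → (w.up P).b6 → (w.up P).b7 → (w.up P).b8 → (w.up P).b9 → (w.up P).b11 → (w.up P).b10) :=
  Iff.rfl

end Shape

/-! ## §2. The node at a run bound by the N-binding over explicit carriers -/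

section Binding

variable (X : PrintedCarriersR) (Y : PrintedCarriers9X) (Z : PrintedCarriers11) (V : PrintedCarriers14R)
  (W : PrintedCarriers15)

/-- The N-binding's `b10` leaf is the LITERAL typing «Theorem 1 (one constant per bounded coupling set) ∧ Theorem 2» of
`X`'s B10 run family (`Iff.rfl`; the `b4`∕`b6` re-bindings of `ofPrintedAllXPN` do not touch `b10`). [cite: Balaban1985UV3, Thm 1 p.257, Thm 2 p.272] -/
theorem ofPrintedAllXPN_b10_iff :
    (Upstream.ofPrintedAllXPN X Y Z V W).b10 ↔ Thm1Printed X.runs10 ∧ Thm2Printed X.runs10 := Iff.rfl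

/-- The same for carriers whose B10 data ARE a family of tower runs `T : I → B10.TowerRun` (`Iff.rfl`). [cite: Balaban1985UV3, Thm 1 p.257, Thm 2 p.272] -/
theorem ofPrintedAllXPN_withTowerRuns10_b10_iff {I : Type} (T : I → TowerRun) :
    (Upstream.ofPrintedAllXPN (X.withTowerRuns10 T) Y Z V W).b10 ↔
      Thm1Printed (fun i => (T i).toRunData) ∧ Thm2Printed (fun i => (T i).toRunData) :=
  Iff.rfl

variable {X Y Z V W} {w : WorldP} {P : B12.RunParams} (hup : w.up P = Upstream.ofPrintedAllXPN X Y Z V W)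

include hup in
/-- **N08 at a run bound by the N-binding, unfolded**: the six in-edge leaves of the binding ⇒ the literal leaf of `X`'s
run family. [cite: Balaban1985UV3, Thm 1 p.257, Thm 2 p.272 (bookkeeping)] -/
theorem b10_main_iff_of_up :
    Dag.B10_main (leavesP w P) ↔
      ((Upstream.ofPrintedAllXPN X Y Z V W).b5 → (Upstream.ofPrintedAllXPN X Y Z V W).b6 →
        (Upstream.ofPrintedAllXPN X Y Z V W).b7 → (Upstream.ofPrintedAllXPN X Y Z V W).b8 →
          (Upstream.ofPrintedAllXPN X Y Z V W).b9 → (Upstream.ofPrintedAllXPN X Y Z V W).b11 →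
            Thm1Printed X.runs10 ∧ Thm2Printed X.runs10) := by
  show ((w.up P).b5 → (w.up P).b6 → (w.up P).b7 → (w.up P).b8 → (w.up P).b9 → (w.up P).b11 → (w.up P).b10) ↔ _
  rw [hup]
  exact Iff.rfl

include hup in
/-- N08 at such a run from the literal leaf (in-edges unused). [cite: Balaban1985UV3, Thm 1 p.257, Thm 2 p.272 (bookkeeping)] -/
theorem b10_main_of_up_of_thms (h1 : Thm1Printed X.runs10) (h2 : Thm2Printed X.runs10) :
    Dag.B10_main (leavesP w P) :=
  (b10_main_iff_of_up hup).2 fun _ _ _ _ _ _ => ⟨h1, h2⟩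

end Binding

/-! ## §3. Literal Theorem 1 from the compact reading under a coupling floor; coarse leaf-system families -/

section Floor

/-- **LITERAL ⇐ COMPACT UNDER A COUPLING FLOOR.**  If every coupling of every run of the family is `≥ gmin > 0`, the
compact reading of Theorem 1 (one constant per window `[gmin, gmax]`) gives the literal one (one constant per bounded
set `(0, gmax]`): the window constant serves, and a bound `gmax < gmin` makes the literal hypothesis void (every run
has the step `k = 0`).  Elementary; the converse direction for bounded families is `B10.thm1Compact_of_thm1Printed`.
[cite: Balaban1985UV3, Thm 1 p.257 with p.257 l.1 (the uniformity clause, both readings)] -/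
theorem thm1Printed_of_thm1Compact_of_floor {I : Type} (runs : I → RunData) {gmin : ℝ} (hmin : 0 < gmin)
    (hfloor : ∀ i k, k ≤ (runs i).K → gmin ≤ (runs i).g k) (h : Thm1PrintedCompact runs) : Thm1Printed runs := by
  intro gmax _
  by_cases hle : gmin ≤ gmax
  · obtain ⟨O1, hO1⟩ := h gmin gmax hmin hle
    exact ⟨O1, fun i hg => (bounds5_iff _ _).2 fun k hk => hO1 i k hk (hfloor i k hk) (hg k hk).2⟩
  · refine ⟨0, fun i hg => ?_⟩
    exact absurd (le_trans (hfloor i 0 (Nat.zero_le _)) (hg 0 (Nat.zero_le _)).2) hle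

/-- On a family with couplings in `[gmin, gtop]`, `0 < gmin`, the two readings of Theorem 1 are EQUIVALENT. [cite: Balaban1985UV3, Thm 1 p.257 (both readings)] -/
theorem thm1Printed_iff_thm1Compact_of_window {I : Type} (runs : I → RunData) {gmin gtop : ℝ} (hmin : 0 < gmin)
    (htop : 0 < gtop) (hwin : ∀ i k, k ≤ (runs i).K → gmin ≤ (runs i).g k ∧ (runs i).g k ≤ gtop) :
    Thm1Printed runs ↔ Thm1PrintedCompact runs :=
  ⟨thm1Compact_of_thm1Printed runs gtop htop fun i k hk => ⟨lt_of_lt_of_le hmin (hwin i k hk).1, (hwin i k hk).2⟩,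
    thm1Printed_of_thm1Compact_of_floor runs hmin fun i k hk => (hwin i k hk).1⟩

variable {I : Type} {C : B10Assembly.Consts} (T : I → TowerRun) (S : ∀ i, LeafSystem C (T i))

/-- **A COARSE leaf-system family has a coupling floor**: if every run's spacing is `≥ ε₀ > 0` then every coupling is
`≥ g·√ε₀` (p. 256: «g_k = g(L^kε)^{1/2}», `L > 1`, the family's bare coupling `g` fixed — `LeafSystem.g_eq`). [cite: Balaban1985UV3, (5) p.256 (the running coupling)] -/
theorem coupling_floor_of_coarse {ε₀ : ℝ} (hε₀ : 0 < ε₀) (hcoarse : ∀ i, ε₀ ≤ (S i).ε) (i : I) (k : ℕ) :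
    C.g * Real.sqrt ε₀ ≤ (T i).g k := by
  rw [(S i).g_eq k]
  unfold gRun
  have hL : 1 ≤ C.L ^ k := one_le_pow₀ C.one_lt_L.le
  have h1 : ε₀ ≤ C.L ^ k * (S i).ε := by nlinarith [hcoarse i, (S i).ε_pos]
  exact mul_le_mul_of_nonneg_left (Real.sqrt_le_sqrt h1) C.g_pos.le

/-- **On a COARSE leaf-system family the LITERAL Theorem 1 holds** (compact reading from the leaf system,
`B10Assembly.thm1Compact_of_leafSystem`, + the floor). [cite: Balaban1985UV3, Thm 1 p.257] -/
theorem thm1Printed_of_leafSystems_of_coarse {ε₀ : ℝ} (hε₀ : 0 < ε₀) (hcoarse : ∀ i, ε₀ ≤ (S i).ε) :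
    Thm1Printed (fun i => (T i).toRunData) :=
  thm1Printed_of_thm1Compact_of_floor (fun i => (T i).toRunData) (mul_pos C.g_pos (Real.sqrt_pos.2 hε₀))
    (fun i k _ => coupling_floor_of_coarse T S hε₀ hcoarse i k) (thm1Compact_and_thm2_of_leafSystem T S).1

/-- **The LITERAL DAG leaf `b10` = «Theorem 1 ∧ Theorem 2» HOLDS on every coarse leaf-system family.** [cite: Balaban1985UV3, Thm 1 p.257 + Thm 2 p.272] -/
theorem b10Leaf_of_leafSystems_of_coarse {ε₀ : ℝ} (hε₀ : 0 < ε₀) (hcoarse : ∀ i, ε₀ ≤ (S i).ε) :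
    Thm1Printed (fun i => (T i).toRunData) ∧ Thm2Printed (fun i => (T i).toRunData) :=
  ⟨thm1Printed_of_leafSystems_of_coarse T S hε₀ hcoarse, (thm1Compact_and_thm2_of_leafSystem T S).2⟩

/-- On a leaf-system family (couplings in (0, 1]) with a spacing floor the two readings of Theorem 1 coincide. [cite: Balaban1985UV3, Thm 1 p.257 (both readings)] -/
theorem thm1Printed_iff_thm1Compact_of_coarse {ε₀ : ℝ} (hε₀ : 0 < ε₀) (hcoarse : ∀ i, ε₀ ≤ (S i).ε) :
    Thm1Printed (fun i => (T i).toRunData) ↔ Thm1PrintedCompact (fun i => (T i).toRunData) :=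
  thm1Printed_iff_thm1Compact_of_window (fun i => (T i).toRunData) (mul_pos C.g_pos (Real.sqrt_pos.2 hε₀)) one_pos
    fun i k hk => ⟨coupling_floor_of_coarse T S hε₀ hcoarse i k, (S i).g_le_one k hk⟩

end Floor

/-! ## §4. N08 BY NAME at a world whose B10 runs are leaf-system tower runs: the three edges -/

section TowerRuns

variable {I : Type} {C : B10Assembly.Consts} {T : I → TowerRun} (S : ∀ i, LeafSystem C (T i)) {X : PrintedCarriersR}
  {Y : PrintedCarriers9X} {Z : PrintedCarriers11} {V : PrintedCarriers14R} {W : PrintedCarriers15} {w : WorldP}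
  {P : B12.RunParams} (hup : w.up P = Upstream.ofPrintedAllXPN (X.withTowerRuns10 T) Y Z V W)

include S hup in
/-- **N08 BY NAME, LITERAL READING, COARSE FAMILIES.**  At a run of a world bound by the N-binding over carriers whose
B10 runs are tower runs carrying leaf systems with common constants and lattice spacings `≥ ε₀ > 0`,
`Dag.B10_main (leavesP w P)` HOLDS (in-edges unused).  The first tree theorem concluding node N08's statement at a
binding over [Balaban1985UV3]'s own leaf system; honest scope: a sub-family bounded away from the continuum. [cite: Balaban1985UV3, Thm 1 p.257 + Thm 2 p.272] -/
theorem b10_main_of_leafSystems_of_coarse {ε₀ : ℝ} (hε₀ : 0 < ε₀) (hcoarse : ∀ i, ε₀ ≤ (S i).ε) :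
    Dag.B10_main (leavesP w P) :=
  have h := b10Leaf_of_leafSystems_of_coarse T S hε₀ hcoarse
  b10_main_of_up_of_thms hup h.1 h.2

include S hup in
/-- **N08, LITERAL READING, FINE FAMILIES — THE NEGATIVE EDGE AT THE NODE.**  With the labelled reader's items of
`…B10DagLeaf` §1 — (R1) the unit configuration at level 0, (R2) the star-bond lower count `s₀ > 0`, (R3) `d(𝔤) ≥ d₀ > 0`
— and ARBITRARILY FINE LATTICES in the family, the literal leaf fails (`B10DagLeaf.not_thm1Printed_of_fineLattices`:
(62) p. 271 carries `d(𝔤) log g_k|T₁^{(k)*}|`), so the node FAILS as soon as its six in-edge leaves hold.  A statement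
about the TYPING `B10.Thm1Printed` at the binding, not about Bałaban's densities. [cite: Balaban1985UV3, (62) p.271, (64) p.273, (1)+(5) p.256, Thm 1 p.257] -/
theorem not_b10_main_of_fineLattices {d₀ s₀ : ℝ} (hd : 0 < d₀) (hs : 0 < s₀) (hU : ∀ i, UnitConfig0 (T i))
    (hS : ∀ i, StarLower (S i) s₀) (hD : ∀ i, DgLower (S i) d₀) (hfine : FineLattices S)
    (h5 : (Upstream.ofPrintedAllXPN (X.withTowerRuns10 T) Y Z V W).b5)
    (h6 : (Upstream.ofPrintedAllXPN (X.withTowerRuns10 T) Y Z V W).b6)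
    (h7 : (Upstream.ofPrintedAllXPN (X.withTowerRuns10 T) Y Z V W).b7)
    (h8 : (Upstream.ofPrintedAllXPN (X.withTowerRuns10 T) Y Z V W).b8)
    (h9 : (Upstream.ofPrintedAllXPN (X.withTowerRuns10 T) Y Z V W).b9)
    (h11 : (Upstream.ofPrintedAllXPN (X.withTowerRuns10 T) Y Z V W).b11) :
    ¬ Dag.B10_main (leavesP w P) := fun h =>
  B10DagLeaf.not_thm1Printed_of_fineLattices T S hd hs hU hS hD hfine
    ((b10_main_iff_of_up hup).1 h h5 h6 h7 h8 h9 h11).1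

include S hup in
/-- The same, as the DICHOTOMY of record for fine families: N08 (literal) holds iff one of its six in-edges FAILS at the
binding — it can only hold vacuously. [cite: Balaban1985UV3, Thm 1 p.257 (typing), (62) p.271] -/
theorem b10_main_iff_inEdge_fails_of_fineLattices {d₀ s₀ : ℝ} (hd : 0 < d₀) (hs : 0 < s₀)
    (hU : ∀ i, UnitConfig0 (T i)) (hS : ∀ i, StarLower (S i) s₀) (hD : ∀ i, DgLower (S i) d₀)
    (hfine : FineLattices S) :
    Dag.B10_main (leavesP w P) ↔
      ¬ ((Upstream.ofPrintedAllXPN (X.withTowerRuns10 T) Y Z V W).b5 ∧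
          (Upstream.ofPrintedAllXPN (X.withTowerRuns10 T) Y Z V W).b6 ∧
          (Upstream.ofPrintedAllXPN (X.withTowerRuns10 T) Y Z V W).b7 ∧
          (Upstream.ofPrintedAllXPN (X.withTowerRuns10 T) Y Z V W).b8 ∧
          (Upstream.ofPrintedAllXPN (X.withTowerRuns10 T) Y Z V W).b9 ∧
          (Upstream.ofPrintedAllXPN (X.withTowerRuns10 T) Y Z V W).b11) := by
  have hleaf : ¬ (leavesP w P).b10 := by
    rw [leavesP_b10, hup]
    exact fun h => B10DagLeaf.not_thm1Printed_of_fineLattices T S hd hs hU hS hD hfine h.1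
  rw [b10_main_iff_not_inEdges_of_not_leaf hleaf]
  show ¬ ((w.up P).b5 ∧ (w.up P).b6 ∧ (w.up P).b7 ∧ (w.up P).b8 ∧ (w.up P).b9 ∧ (w.up P).b11) ↔ _
  rw [hup]

include S in
/-- **The COMPACT node holds for these carriers from the leaf systems ALONE** (`DagDischarged.b10Compact` =
`B10.Thm1PrintedCompact ∧ B10.Thm2Printed`; by name `DagDischarged.b10Compact_withTowerRuns10_of_leafSystems`). [cite: Balaban1985UV3, Thm 1 p.257 (compact reading) + Thm 2 p.272] -/
theorem b10Compact_of_leafSystems : b10Compact (X.withTowerRuns10 T).toPrintedCarriers :=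
  DagDischarged.b10Compact_withTowerRuns10_of_leafSystems X T S

include S in
/-- **N08 BY NAME, COMPACT READING (the Q2 candidate binding).**  At a run of a world whose upstream is the N-binding
over these carriers WITH THE ONE SLOT `b10` RE-READ as `DagDischarged.b10Compact` (written as a structure update; this
module introduces no definition), `Dag.B10_main (leavesP w P)` HOLDS from the leaf systems alone — every run family,
fine lattices included, in-edges unused. [cite: Balaban1985UV3, Thm 1 p.257 (compact reading, cell GAPS G-B10-01) + Thm 2 p.272] -/
theorem b10_main_of_upCompact
    (hupC : w.up P = { Upstream.ofPrintedAllXPN (X.withTowerRuns10 T) Y Z V W with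
      b10 := b10Compact (X.withTowerRuns10 T).toPrintedCarriers }) :
    Dag.B10_main (leavesP w P) := by
  show (w.up P).b5 → (w.up P).b6 → (w.up P).b7 → (w.up P).b8 → (w.up P).b9 → (w.up P).b11 → (w.up P).b10
  rw [hupC]
  exact fun _ _ _ _ _ _ => b10Compact_of_leafSystems S

/-- **The record-predicate form (the shape a `stub_N08` closes against, dagwriter `S_N08 Rec := AtRecord Rec Dag.B10_main`):**
for ANY predicate `Rec` on binding worlds under which, at every run, the upstream is the compact re-binding over carriers
whose B10 runs are leaf-system tower runs, N08 holds at every `Rec`-world and every run.  What a NODE 00 B10-pin stage +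
the Q2 word (C) + a leaf system ON THE PINNED TOWERS would instantiate; nothing of that is asserted here. [cite: Balaban1985UV3, Thm 1 p.257 + Thm 2 p.272 (bookkeeping shape)] -/
theorem b10_main_at_record_of_leafSystemPin (Rec : WorldP → Prop)
    (hpin : ∀ w, Rec w → ∀ P : B12.RunParams,
      ∃ (X : PrintedCarriersR) (Y : PrintedCarriers9X) (Z : PrintedCarriers11) (V : PrintedCarriers14R)
        (W : PrintedCarriers15) (I : Type) (C : B10Assembly.Consts) (T : I → TowerRun),
        Nonempty (∀ i, LeafSystem C (T i)) ∧
          w.up P = { Upstream.ofPrintedAllXPN (X.withTowerRuns10 T) Y Z V W with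
            b10 := b10Compact (X.withTowerRuns10 T).toPrintedCarriers }) :
    ∀ w, Rec w → ∀ P, Dag.B10_main (leavesP w P) := by
  intro w hw P
  obtain ⟨X, Y, Z, V, W, I, C, T, ⟨S⟩, hupC⟩ := hpin w hw P
  exact b10_main_of_upCompact S hupC

end TowerRuns

/-! ## §5. The three edges, unconditionally, on the model family `B10DagLeaf.logRun` -/

section Model

variable (X : PrintedCarriersR) (Y : PrintedCarriers9X) (Z : PrintedCarriers11) (V : PrintedCarriers14R)
  (W : PrintedCarriers15) {w : WorldP} {P : B12.RunParams}

/-- On the model rebinding (all depths K, spacing 2^{−K}: FINE) the LITERAL node holds iff an in-edge fails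
(`B10DagLeaf.not_thm1Printed_logRun` by name). [cite: Balaban1985UV3, Thm 1 p.257 (typing), (62) p.271, (64) p.273] -/
theorem b10_main_logRun_iff
    (hup : w.up P = Upstream.ofPrintedAllXPN (X.withTowerRuns10 fun K : ℕ => logRun K) Y Z V W) :
    Dag.B10_main (leavesP w P) ↔
      ¬ ((Upstream.ofPrintedAllXPN (X.withTowerRuns10 fun K : ℕ => logRun K) Y Z V W).b5 ∧
          (Upstream.ofPrintedAllXPN (X.withTowerRuns10 fun K : ℕ => logRun K) Y Z V W).b6 ∧
          (Upstream.ofPrintedAllXPN (X.withTowerRuns10 fun K : ℕ => logRun K) Y Z V W).b7 ∧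
          (Upstream.ofPrintedAllXPN (X.withTowerRuns10 fun K : ℕ => logRun K) Y Z V W).b8 ∧
          (Upstream.ofPrintedAllXPN (X.withTowerRuns10 fun K : ℕ => logRun K) Y Z V W).b9 ∧
          (Upstream.ofPrintedAllXPN (X.withTowerRuns10 fun K : ℕ => logRun K) Y Z V W).b11) := by
  have hleaf : ¬ (leavesP w P).b10 := by
    rw [leavesP_b10, hup]
    exact fun h => B10DagLeaf.not_thm1Printed_logRun h.1
  rw [b10_main_iff_not_inEdges_of_not_leaf hleaf]
  show ¬ ((w.up P).b5 ∧ (w.up P).b6 ∧ (w.up P).b7 ∧ (w.up P).b8 ∧ (w.up P).b9 ∧ (w.up P).b11) ↔ _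
  rw [hup]

/-- … while the COMPACT node holds there outright (`B10DagLeaf.logLeafSystem`). [cite: Balaban1985UV3, Thm 1 p.257 (compact reading) + Thm 2 p.272] -/
theorem b10_main_logRun_compact
    (hupC : w.up P = { Upstream.ofPrintedAllXPN (X.withTowerRuns10 fun K : ℕ => logRun K) Y Z V W with
      b10 := b10Compact (X.withTowerRuns10 fun K : ℕ => logRun K).toPrintedCarriers }) :
    Dag.B10_main (leavesP w P) :=
  b10_main_of_upCompact (fun K => logLeafSystem K) hupC

/-- … and the LITERAL node HOLDS on every SINGLE-SPACING sub-family of the model (one depth `K₀`, spacing `2^{−K₀}`: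
coarse).  Only the ε → 0 family defeats the literal leaf. [cite: Balaban1985UV3, Thm 1 p.257] -/
theorem b10_main_logRun_single (K₀ : ℕ)
    (hup : w.up P = Upstream.ofPrintedAllXPN (X.withTowerRuns10 fun _ : Unit => logRun K₀) Y Z V W) :
    Dag.B10_main (leavesP w P) :=
  b10_main_of_leafSystems_of_coarse (fun _ => logLeafSystem K₀) hup (logLeafSystem K₀).ε_pos fun _ => le_rfl

end Model

/-! ## §6. Stage 3 of NODE 00 does not decide leaf `b10` -/

section Stage3

variable (θ : Stage3Params) (X : PrintedCarriersR) (Y : PrintedCarriers9X) (Z : PrintedCarriers11)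
  (V : PrintedCarriers14R) (W : PrintedCarriers15)

/-- The B10 run family of the Stage-3 bundle of record `carriers₃ θ X` is `X`'s — FREE (`rfl`; the B4 ∕ B5 ∕ B6 ∕ B7
substitutions of record do not touch it). [cite: Balaban1985UV3, Thm 1 p.257, Thm 2 p.272 (dictionary, bookkeeping)] -/
theorem carriers₃_groupB10 : (carriers₃ θ X).I10 = X.I10 ∧ (carriers₃ θ X).runs10 = X.runs10 := ⟨rfl, rfl⟩

/-- Hence the `b10` leaf over `carriers₃ θ X` is the literal leaf of `X`'s run family (`Iff.rfl`). [cite: Balaban1985UV3, Thm 1 p.257, Thm 2 p.272 (bookkeeping)] -/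
theorem carriers₃_b10_iff :
    (Upstream.ofPrintedAllXPN (carriers₃ θ X) Y Z V W).b10 ↔ Thm1Printed X.runs10 ∧ Thm2Printed X.runs10 := Iff.rfl

variable {θ X Y Z V W} (hθ : θ.toStage1Params.Admissible) {w : WorldP} {P : B12.RunParams}
  (hup : w.up P = Upstream.ofPrintedAllXPN (carriers₃ θ X) Y Z V W)

include hθ hup in
/-- **N08 at a Stage-3 run, unfolded** (b5 and b7 discharged by the pinned [B5] ∕ [B7] groups of record, `Node00.carriers₁_b5`,
`Node00.carriers₂_b7`): `Dag.B10_main (leavesP w P)` ↔ «the block leaf of `D6OfRecord θ` → `X`'s faithful [B8] leaf →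
`B9LeafX Y` → `B11Leaf Z` → the LITERAL leaf of `X`'s FREE run family».  Neither provable nor refutable from the record
until a stage pins `runs10`. [cite: Balaban1985UV3, Thm 1 p.257, Thm 2 p.272 (bookkeeping at the Stage-3 record)] -/
theorem b10_main_iff_of_up₃ :
    Dag.B10_main (leavesP w P) ↔
      (B6BlockParam (D6OfRecord θ) → (Upstream.ofPrintedAllXPN X Y Z V W).b8 → B9LeafX Y → B11Leaf Z →
        Thm1Printed X.runs10 ∧ Thm2Printed X.runs10) := by
  have h5 : (Upstream.ofPrintedAllXPN (carriers₃ θ X) Y Z V W).b5 :=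
    carriers₁_b5 θ.toStage1Params hθ _ Y Z V W
  have h7 : (Upstream.ofPrintedAllXPN (carriers₃ θ X) Y Z V W).b7 := carriers₂_b7 θ.toStage2Params _ Y Z V W
  show ((w.up P).b5 → (w.up P).b6 → (w.up P).b7 → (w.up P).b8 → (w.up P).b9 → (w.up P).b11 → (w.up P).b10) ↔ _
  rw [hup]
  exact ⟨fun h h6 h8 h9 h11 => h h5 h6 h7 h8 h9 h11, fun h _ h6 _ h8 h9 h11 => h h6 h8 h9 h11⟩

/-- **Admissible Stage-3 parameters EXIST** (`D = 4`: the `D = 4` Stage-1 witness of `Node00.Stage1Params.exists_admissible`,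
coefficient algebra `ℂ`, `d₆ = 3`, `ℓ₆ = L − 1`, band `b₀ = b₁ = 1`, `δ₀ = 2/L`). [cite: Balaban1984PropagatorsII, (2.1)–(2.4) p.224, (2.16) p.225 (parameter dictionary; bookkeeping witness)] -/
theorem exists_stage3Params_admissible : ∃ θ : Stage3Params, θ.toStage1Params.Admissible := by
  obtain ⟨θ₁, hθ₁, hD⟩ := Stage1Params.exists_admissible
  have hL : θ₁.L - 1 + 1 = θ₁.L := Nat.sub_add_cancel θ₁.hL.2.le
  have hd : 3 + 1 = θ₁.D := by omega
  have hb : (0 : ℝ) < 1 ∧ (1 : ℝ) ≤ 1 := ⟨one_pos, le_rfl⟩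
  have hδ : (0 : ℝ) < 2 / (((θ₁.L - 1 : ℕ) : ℝ) + 1) ∧
      2 / (((θ₁.L - 1 : ℕ) : ℝ) + 1) ≤ 2 / (((θ₁.L - 1 : ℕ) : ℝ) + 1) := ⟨by positivity, le_rfl⟩
  exact ⟨{ θ₁ with
    𝔸 := ℂ, d₆ := 3, ℓ₆ := θ₁.L - 1, hd₆ := hd, hℓ₆ := hL, b₀ := 1, b₁ := 1, hb := hb,
    δ₀ := 2 / (((θ₁.L - 1 : ℕ) : ℝ) + 1), hδ₀ := hδ }, hθ₁⟩

/-- **A Stage-3 world of record with leaf `b10` TRUE at every run**: the B10 run family EMPTY (the `PrintedCarriersR`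
witness of `Node00.Satisfiable` has `I10 = PEmpty`), Theorem 1 ∧ Theorem 2 vacuous. [cite: Balaban1985UV3, Thm 1 p.257 (typing; bookkeeping witness)] -/
theorem exists_isWorldOfRecord₃_b10 : ∃ w : WorldP, IsWorldOfRecord₃ w ∧ ∀ P, (leavesP w P).b10 := by
  obtain ⟨θ, hθ⟩ := exists_stage3Params_admissible
  obtain ⟨X⟩ := nonempty_printedCarriersR
  obtain ⟨Y⟩ := nonempty_printedCarriers9X
  obtain ⟨Z⟩ := nonempty_printedCarriers11
  obtain ⟨V⟩ := nonempty_printedCarriers14R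
  obtain ⟨W⟩ := nonempty_printedCarriers15
  obtain ⟨w⟩ := nonempty_worldP
  refine ⟨WorldP.withUp w fun _ =>
      Upstream.ofPrintedAllXPN (carriers₃ θ (X.withTowerRuns10 fun i : PEmpty => nomatch i)) Y Z V W,
    isWorldOfRecord₃_of_up θ hθ _ Y Z V W _ rfl, fun P => ?_⟩
  show Thm1Printed (fun i : PEmpty => (nomatch i : TowerRun).toRunData) ∧
    Thm2Printed (fun i : PEmpty => (nomatch i : TowerRun).toRunData)
  exact ⟨fun _ _ => ⟨0, fun i => nomatch i⟩, fun i => nomatch i⟩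

/-- **A Stage-3 world of record with leaf `b10` FALSE at every run**: the B10 run family := the b10 lineage's model family
`B10DagLeaf.logRun` (`B10DagLeaf.not_thm1Printed_logRun`). [cite: Balaban1985UV3, Thm 1 p.257 (typing), (62) p.271 (bookkeeping witness)] -/
theorem exists_isWorldOfRecord₃_not_b10 : ∃ w : WorldP, IsWorldOfRecord₃ w ∧ ∀ P, ¬ (leavesP w P).b10 := by
  obtain ⟨θ, hθ⟩ := exists_stage3Params_admissible
  obtain ⟨X⟩ := nonempty_printedCarriersR
  obtain ⟨Y⟩ := nonempty_printedCarriers9X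
  obtain ⟨Z⟩ := nonempty_printedCarriers11
  obtain ⟨V⟩ := nonempty_printedCarriers14R
  obtain ⟨W⟩ := nonempty_printedCarriers15
  obtain ⟨w⟩ := nonempty_worldP
  refine ⟨WorldP.withUp w fun _ =>
      Upstream.ofPrintedAllXPN (carriers₃ θ (X.withTowerRuns10 fun K : ℕ => logRun K)) Y Z V W,
    isWorldOfRecord₃_of_up θ hθ _ Y Z V W _ rfl, fun P h => ?_⟩
  exact B10DagLeaf.not_thm1Printed_logRun h.1

/-- **STAGE 3 DOES NOT DECIDE LEAF `b10`** (both witnesses side by side): a NODE 00 stage pinning the B10 run family —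
and the Q2 word on its reading — must precede any discharge or r-booking of N08. [cite: Balaban1985UV3, Thm 1 p.257, Thm 2 p.272 (bookkeeping)] -/
theorem isWorldOfRecord₃_b10_undecided :
    (∃ w : WorldP, IsWorldOfRecord₃ w ∧ ∀ P, (leavesP w P).b10) ∧
      (∃ w : WorldP, IsWorldOfRecord₃ w ∧ ∀ P, ¬ (leavesP w P).b10) :=
  ⟨exists_isWorldOfRecord₃_b10, exists_isWorldOfRecord₃_not_b10⟩

/-- Why N08 has no Carriers3-pattern slot theorem «modulo its leaf over all carriers» (the shape of
`Node00.b6_main_of_isWorldOfRecord₃_of`): the hypothesis «every bundle's run family satisfies the literal leaf» is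
REFUTABLE (rebind the runs to `logRun`), so such a theorem would be vacuous. [cite: Balaban1985UV3, Thm 1 p.257 (typing), (62) p.271] -/
theorem not_forall_b10_leaf : ¬ ∀ X : PrintedCarriersR, Thm1Printed X.runs10 ∧ Thm2Printed X.runs10 := by
  obtain ⟨X⟩ := nonempty_printedCarriersR
  exact fun h => B10DagLeaf.not_thm1Printed_logRun (h (X.withTowerRuns10 fun K : ℕ => logRun K)).1

end Stage3

end Literature.MathematicalPhysics.QuantumFieldTheory.Balaban1983to89.B10NodeKnit

end
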